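import Summits.QuantumFields.YangMills.Theorems.BalabanUVNodesN15LiveGluedPropagatorZeroField
import HarnessLib

/-!
# N15 = NE2 — Σ-col (I-b): THE INCREMENT LETTER `|G(U_A) − Δ_a⁻¹ ⊗ 1_ι| ≤ K·κ_e·r_A·e^{−δd}` FOR dag-n15-c's LIVE GLUED COVARIANT PROPAGATORS, BOTH SPACINGS
# (dag-n15-a g28, programme Σ-col, FILE (I-b); node N15 = NE2; `--kind proof --supports stmt-QuantumFields-27366 --as helper`, count-neutral, ONE theorem, 0 def)

WHY.  FLAG №13's located burden («non-abelian `G(U)` dressing of NE2 ← N15's U-blind pin») asks how far dag-n15-c's live glued covariant propagator `X(U)` (FILE 127∕128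
`cvGlued`∕`cvGlued'`, bond field `U = e^{ηĀ′}` of a small skew-Hermitian potential) is from the pin's `G ⊗ 1_ι` (`G = Δ_a⁻¹`, part 39).  FILE (I) `…LiveGluedPropagatorZeroField`
proved they AGREE at `A′ = 0` and the exact identity `X − G ⊗ 1 = X ∘ V_R ∘ (G ⊗ 1)`.  Here the ESTIMATE: in FILE 133's regime the difference has the block majorant
`K·κ_e·r_A·e^{−δ|y − y′|}` on the cover's unit torus at BOTH spacings — linear in the field letter `r_A`, constants from `d, L, a, ι` only.

HOW.  FILE (I) §5's identity; FILE 133 `sf_cvGlued_pair_spec` (majorant of `X`, `X(Δ_U + N_L) = 1`); n15-w2 `twoSidedLetters_curvCoef_one_of_meanGauge` (rows of the exact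
species' coefficients `≤ 14e(1+|J|)κ_e(1+|J|)(5+2d)r_A`) through M1 `hasMaj_unstackM`; FILE 21 `uniform_layer_fullGM₂` (`G ⊗ 1`, `dPiecesM₂` at both spacings; fine blocks by
`blkFine_comp_kingPrV`) through `hasMaj_stack`; FILE 28 `unstackM_comp_stack_eq_speciesOpM_comp`; `hasMaj_diagK_comp_exp`; [B11] `hasMaj_comp_exp` with Lemma 2.1's row sum on the
unit torus (margin `δ_G∕2`).  MODEL operator ∕ class ∕ pairing ∕ carriers exactly as FILE 133 — NOT [B9] Thm 3.1 as printed; an estimate on the OPERATOR-layer ingredient only; no count.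
[cite: Balaban1985BackgroundPropagators, (3.35) p.396, (3.50)–(3.53) p.400, (3.62)–(3.65) pp.402–403, p.399; Balaban1984PropagatorsI, (1.69)–(1.71) pp.29–30; Balaban1984PropagatorsII, (2.52)–(2.56) pp.232–233, Lemma 2.1 (2.61) p.234]
-/

open scoped BigOperators Matrix Matrix.Norms.Frobenius

namespace Summit.QuantumFields.YangMills.BalabanUVNodes.N15.GluedZeroField

open Literature.MathematicalPhysics.QuantumFieldTheory.Balaban1983to89
open Literature.MathematicalPhysics.QuantumFieldTheory.Balaban1983to89.B5Prop11Plancherel (Tor fine)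
open Literature.MathematicalPhysics.QuantumFieldTheory.Balaban1983to89.B11SectG (BlockNorm HasMaj RowSum hasMaj_comp_exp)
open Literature.MathematicalPhysics.QuantumFieldTheory.Balaban1983to89.B6UnitTorusCarrier (unitTorusGeo unitTorusGeo_dist_nonneg triangle254_unitTorusGeo rowSum_unitTorusGeo)
open Literature.MathematicalPhysics.QuantumFieldTheory.Balaban1983to89.T4EtaRateCoeffDefect (diagK)
open Literature.MathematicalPhysics.QuantumFieldTheory.Balaban1983to89.Beta.AveragingCorrectionJets (adCLM)
open Literature.MathematicalPhysics.QuantumFieldTheory.King1986.Torus (blockOf)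
open Literature.Barriers.QuantumFields (traceForm)
open Summit.QuantumFields.YangMills.BalabanUVNodes.N15.BackgroundLayer (covLapM tCoefA tCoefC gavgM speciesOpM stack unstackM blkPair hasMaj_stack hasMaj_unstackM dPiecesM₂
  dPiecesM₂_inl dPiecesM₂_inr uniform_layer_fullGM₂ unstackM_comp_stack_eq_speciesOpM_comp)
open Summit.QuantumFields.YangMills.BalabanUVNodes.N15.BackgroundModel (kappa_ofBlocks)
open Summit.QuantumFields.YangMills.BalabanUVNodes.N15.SiteLayer (hasMaj_diagK_comp_exp)
open Summit.QuantumFields.YangMills.BalabanUVNodes.N15.VectorPiece (bshiftEquiv kingPrV tensorId kingPrV_bshiftEquiv_pow fibre_conn_kingPrV bshiftEquiv_comm blkFine_comp_kingPrV)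
open Summit.QuantumFields.YangMills.BalabanUVNodes.N15.MatrixSpecies (coordMat basisConst basisConst_nonneg liftBlk)
open Summit.QuantumFields.YangMills.BalabanUVNodes.N15.TwoGrid (gOp)
open Summit.QuantumFields.YangMills.BalabanUVNodes.N15.CurvedSpecies (gaugePair expTrField curvCoefC_one curvCoefA_one twoSidedLetters_curvCoef_one_of_meanGauge
  coordMat_adCLM_transpose_eq_neg_of_conjTranspose)
open Summit.QuantumFields.YangMills.BalabanUVNodes.N15.Gluing (cvM CvX CvX' cvBlk CvNorm cvNL cvNL' cvGlued cvGlued' sf_cvGlued_pair_spec gavgM_conjTranspose_of_skew conj_one_exp_eq_expTrField)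

variable {d : ℕ}

/-! ## The increment letter: the non-abelian dressing of NE2's operator-layer ingredient is `O(|A|)` with exponential decay -/

section Letter

variable {L : ℕ} [NeZero L]

set_option maxHeartbeats 800000 in
/-- ★★★ **THE INCREMENT LETTER `|G(U_A) − G ⊗ 1_ι| ≤ K·κ_e·r_A·e^{−δd}`** — the first kernel-checked ESTIMATE relating dag-n15-c's live glued covariant propagator to the U-blind
pin: in FILE 133's regime (odd `L ≥ 7`, `a > 0`, `k ≥ 1`, `L^m ≥ w₀`; a skew-Hermitian fine potential `A′` in the C² window at scale `r_A`, `2(2+d)(5+2d)r_A ≤ 1`, scale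
`≤ R₀`), the glued propagator of the mean-gauge bond field `U = exp(η Ā′)` MINUS Bałaban's `Δ_a⁻¹ ⊗ 1_ι` has the block majorant `K·κ_e·r_A·e^{−δ|y−y′|}` on the cover's unit
torus, `K, δ, w₀, R₀` depending on `d, L, a, ι` only — LINEAR in the field letter `r_A`.  Proof: §4's exact increment identity `X − G ⊗ 1 = X ∘ V_R ∘ (G ⊗ 1)`; FILE 133's
majorant of `X`; n15-w2's coefficient letters of the exact species `V_R` of the mean gauge (`twoSidedLetters_curvCoef_one_of_meanGauge`, rows `≤ 14e(1+|J|)κ_e(1+|J|)(5+2d)r_A`)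
through M1 `hasMaj_unstackM`; FILE 21's uniform letters of `G ⊗ 1` and its two-sided quotients `dPiecesM₂` through `hasMaj_stack`; FILE 28 `unstackM_comp_stack_eq_speciesOpM_comp`;
[B11] `hasMaj_comp_exp` with Lemma 2.1's row sum on the unit torus.  MODEL operator ∕ class ∕ pairing ∕ carriers as in FILE 133; NOT [B9] Thm 3.1 as printed; no count.
[cite: Balaban1985BackgroundPropagators, (3.35) p.396, (3.50)–(3.53) p.400, (3.62)–(3.65) pp.402–403, p.399 («expanding with respect to A»); Balaban1984PropagatorsI, (1.69)–(1.71) pp.29–30; Balaban1984PropagatorsII, (2.52)–(2.56) pp.232–233, Lemma 2.1 (2.61) p.234] -/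
theorem exists_hasMaj_cvGlued_sub_tensorId_gOp (hL : Odd L ∧ 1 < L) (hL7 : 7 ≤ L) {a : ℝ} (ha : 0 < a) (ι : Type) [Fintype ι] [DecidableEq ι] [Nonempty ι] :
    ∃ δ w₀ R₀ K : ℝ, 0 < δ ∧ 0 < R₀ ∧ 0 < K ∧
      ∀ (mv kk r : ℕ), 1 ≤ kk → w₀ ≤ ((L ^ mv : ℕ) : ℝ) →
      ∀ {mm : Type} [Fintype mm] [DecidableEq mm] (e : Matrix mm mm ℂ ≃L[ℝ] (ι → ℝ)), (∀ A B : Matrix mm mm ℂ, traceForm A B = e A ⬝ᵥ e B) →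
      ∀ (A' : Fin (d + 1) → CvX' d L mv kk r hL → Matrix mm mm ℂ), (∀ μ x', (A' μ x')ᴴ = -A' μ x') →
      ∀ (rA : ℝ), 0 ≤ rA → (∀ μ x', ‖A' μ x'‖ ≤ rA) →
        (∀ μ κ x', ‖A' μ (bshiftEquiv (cvM d L mv kk hL) (L ^ r * L ^ kk) κ x') - A' μ x'‖ ≤ rA * ((((L ^ r * L ^ kk : ℕ) : ℝ))⁻¹)) →
        (∀ μ κ x', ‖(A' μ (bshiftEquiv (cvM d L mv kk hL) (L ^ r * L ^ kk) κ x') - A' μ x') -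
            (A' μ (bshiftEquiv (cvM d L mv kk hL) (L ^ r * L ^ kk) κ ((bshiftEquiv (cvM d L mv kk hL) (L ^ r * L ^ kk) μ).symm x')) -
              A' μ ((bshiftEquiv (cvM d L mv kk hL) (L ^ r * L ^ kk) μ).symm x'))‖ ≤ rA * ((((L ^ r * L ^ kk : ℕ) : ℝ))⁻¹) * ((((L ^ r * L ^ kk : ℕ) : ℝ))⁻¹)) →
        2 * ((1 + Fintype.card (Fin (d + 1))) * ((3 + 2 * ((d : ℝ) + 1)) * rA)) ≤ 1 →
        (14 * Real.exp 1 * (1 + Fintype.card (Fin (d + 1))) * basisConst e * ((1 + Fintype.card (Fin (d + 1))) * ((3 + 2 * ((d : ℝ) + 1)) * rA))) * (1 + Fintype.card (Fin (d + 1) ⊕ Fin (d + 1))) ≤ R₀ →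
        HasMaj (CvNorm d L mv kk hL ι) (CvNorm d L mv kk hL ι)
          (cvGlued d L mv kk hL a ((((L ^ kk : ℕ) : ℝ))⁻¹) ι e (fun _ _ => (1 : Matrix mm mm ℂ))
              (fun μ x => NormedSpace.exp (((((L ^ kk : ℕ) : ℝ))⁻¹) • gavgM (Matrix mm mm ℂ) (Fin (d + 1)) (kingPrV L kk r (cvM d L mv kk hL)) A' μ x)) (cvNL d L mv kk hL a ι) (fun _ => 0) -
            tensorId ι (gOp (cvM d L mv kk hL) (L ^ kk) a))
          (fun y y' => K * basisConst e * rA * Real.exp (-(δ * (unitTorusGeo L kk (cvM d L mv kk hL)).dist y y'))) ∧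
        HasMaj (BlockNorm.ofBlocks (unitTorusGeo L kk (cvM d L mv kk hL)) (liftBlk (fun b : CvX' d L mv kk r hL => blockOf (L ^ r * L ^ kk) (cvM d L mv kk hL) b.1) ι))
          (BlockNorm.ofBlocks (unitTorusGeo L kk (cvM d L mv kk hL)) (liftBlk (fun b : CvX' d L mv kk r hL => blockOf (L ^ r * L ^ kk) (cvM d L mv kk hL) b.1) ι))
          (cvGlued' d L mv kk r hL a ((((L ^ r * L ^ kk : ℕ) : ℝ))⁻¹) ι e (fun _ _ => (1 : Matrix mm mm ℂ)) (fun μ x' => NormedSpace.exp (((((L ^ r * L ^ kk : ℕ) : ℝ))⁻¹) • A' μ x'))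
              (cvNL' d L mv kk r hL a ι) (fun _ => 0) -
            tensorId ι (gOp (cvM d L mv kk hL) (L ^ r * L ^ kk) a))
          (fun y y' => K * basisConst e * rA * Real.exp (-(δ * (unitTorusGeo L kk (cvM d L mv kk hL)).dist y y'))) := by
  have hLpos : 0 < L := Nat.pos_of_ne_zero (NeZero.ne L)
  have hL2 : 2 ≤ L := le_trans (by norm_num) hL7
  -- FILE 133 (the live pair: majorant of `X` and `X(Δ_U + N_L) = 1`) and FILE 21 (the flat family's uniform letters, rate `δ_G ≤ δ₁`)
  obtain ⟨δ₁, w₀, R₀, B, hδ₁, hR₀, hB, H⟩ := sf_cvGlued_pair_spec (d := d) hL hL7 ha ι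
  obtain ⟨δG, βG, m₀, cT, mT, hδG, hδG₁, hβG, -, -, -, -, HG⟩ := uniform_layer_fullGM₂ d ι hL.1 hL2 hL ha (γ := 1 / 16) (by norm_num) le_rfl 0 hδ₁ le_rfl
  -- the row sum of Lemma 2.1 at the margin `δ_G∕2`, and the constant
  have hσ : 0 < δG / 2 := by positivity
  set cr : ℝ := B4Sect5Proof.latticeConst (d + 1) (δG / 2) + 1 with hcr
  have hcr0 : 0 < cr := by have := B4Sect5Proof.latticeConst_nonneg (d + 1) hσ.le; rw [hcr]; linarith
  set R₁ : ℝ := 14 * Real.exp 1 * (1 + Fintype.card (Fin (d + 1))) * ((1 + Fintype.card (Fin (d + 1))) * (3 + 2 * ((d : ℝ) + 1))) * (1 + Fintype.card (Fin (d + 1) ⊕ Fin (d + 1)))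
    with hR₁
  have hR₁0 : 0 < R₁ := by positivity
  refine ⟨δG / 2, w₀, R₀, B * R₁ * βG * cr, hσ, hR₀, by positivity, fun mv kk r hk hw₀ => ?_⟩
  intro mm _ _ e he A' hA' rA hrA h1 h2 h3 hr2 hRle
  have hkpos : (0 : ℝ) < ((L ^ kk : ℕ) : ℝ) := Nat.cast_pos.mpr (pow_pos hLpos kk)
  have hrkpos : (0 : ℝ) < ((L ^ r * L ^ kk : ℕ) : ℝ) := Nat.cast_pos.mpr (Nat.mul_pos (pow_pos hLpos r) (pow_pos hLpos kk))
  have hη : (0 : ℝ) < ((((L ^ kk : ℕ) : ℝ))⁻¹) := inv_pos.mpr hkpos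
  have hη' : (0 : ℝ) < ((((L ^ r * L ^ kk : ℕ) : ℝ))⁻¹) := inv_pos.mpr hrkpos
  have hN : ((((L ^ kk : ℕ) : ℝ))⁻¹) = ((L ^ r : ℕ) : ℝ) * ((((L ^ r * L ^ kk : ℕ) : ℝ))⁻¹) := by
    have hr0 : ((L ^ r : ℕ) : ℝ) ≠ 0 := Nat.cast_ne_zero.mpr (pow_ne_zero _ (NeZero.ne L))
    rw [Nat.cast_mul]; field_simp
  have hη1 : ((((L ^ kk : ℕ) : ℝ))⁻¹) ≤ 1 := inv_le_one_of_one_le₀ (by exact_mod_cast Nat.one_le_pow kk L hLpos)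
  have hC₀ : (0 : ℝ) ≤ 2 * ((d : ℝ) + 1) := by positivity
  have hCθ : ((2 * ((d + 1) * (L ^ r - 1)) : ℕ) : ℝ) * ((((L ^ r * L ^ kk : ℕ) : ℝ))⁻¹) ≤ 2 * ((d : ℝ) + 1) * ((((L ^ kk : ℕ) : ℝ))⁻¹) := by
    have hsub : (((L ^ r - 1 : ℕ)) : ℝ) ≤ ((L ^ r : ℕ) : ℝ) := by exact_mod_cast Nat.sub_le _ _
    have hcast : ((2 * ((d + 1) * (L ^ r - 1)) : ℕ) : ℝ) = 2 * ((d : ℝ) + 1) * (((L ^ r - 1 : ℕ)) : ℝ) := by push_cast; ring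
    rw [hcast, hN]
    calc 2 * ((d : ℝ) + 1) * (((L ^ r - 1 : ℕ)) : ℝ) * ((((L ^ r * L ^ kk : ℕ) : ℝ))⁻¹) ≤ 2 * ((d : ℝ) + 1) * ((L ^ r : ℕ) : ℝ) * ((((L ^ r * L ^ kk : ℕ) : ℝ))⁻¹) :=
          mul_le_mul_of_nonneg_right (mul_le_mul_of_nonneg_left hsub hC₀) hη'.le
      _ = 2 * ((d : ℝ) + 1) * (((L ^ r : ℕ) : ℝ) * ((((L ^ r * L ^ kk : ℕ) : ℝ))⁻¹)) := by ring
  -- King's pairing geometry and skewness in coordinates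
  have hcomm := fun μ κ (x : CvX' d L mv kk r hL) => bshiftEquiv_comm (cvM d L mv kk hL) (L ^ r * L ^ kk) μ κ x
  have hconn := fun (f : CvX' d L mv kk r hL → Matrix mm mm ℂ) (β : ℝ)
      (hf : ∀ κ x, ‖f (bshiftEquiv (cvM d L mv kk hL) (L ^ r * L ^ kk) κ x) - f x‖ ≤ β) => fibre_conn_kingPrV L kk r (cvM d L mv kk hL) f β hf
  have hblk := fun μ (x' : CvX' d L mv kk r hL) => kingPrV_bshiftEquiv_pow L kk r (cvM d L mv kk hL) μ x'
  have hAm : ∀ μ x, (gavgM (Matrix mm mm ℂ) (Fin (d + 1)) (kingPrV L kk r (cvM d L mv kk hL)) A' μ x)ᴴ = -gavgM (Matrix mm mm ℂ) (Fin (d + 1)) (kingPrV L kk r (cvM d L mv kk hL)) A' μ x := gavgM_conjTranspose_of_skew (kingPrV L kk r (cvM d L mv kk hL)) hA'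
  have hA'c := fun μ x' => coordMat_adCLM_transpose_eq_neg_of_conjTranspose e he (hA' μ x')
  have hAmc := fun μ x => coordMat_adCLM_transpose_eq_neg_of_conjTranspose e he (hAm μ x)
  obtain ⟨hc, hcA, hc', hcA', -, -, -, -, -, -, -, -, -, -, -⟩ :=
    twoSidedLetters_curvCoef_one_of_meanGauge e (π := (kingPrV L kk r (cvM d L mv kk hL))) (s := bshiftEquiv (cvM d L mv kk hL) (L ^ kk))
      (s' := bshiftEquiv (cvM d L mv kk hL) (L ^ r * L ^ kk)) (N := L ^ r) (θ := ((((L ^ kk : ℕ) : ℝ))⁻¹)) (Cπ := ((2 * ((d + 1) * (L ^ r - 1)) : ℕ) : ℝ)) (C₀ := 2 * ((d : ℝ) + 1))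
      hcomm hconn hblk hη' hN hη hη1 le_rfl hC₀ hCθ hrA hr2 hA'c hAmc h1 h2 h3
  rw [curvCoefC_one, curvCoefA_one, ← conj_one_exp_eq_expTrField e ((((L ^ kk : ℕ) : ℝ))⁻¹) hAm] at hc hcA
  rw [curvCoefC_one, curvCoefA_one, ← conj_one_exp_eq_expTrField e ((((L ^ r * L ^ kk : ℕ) : ℝ))⁻¹) hA'] at hc' hcA'
  -- the transporters of the live operator carry no cube gauges: strip the `1 ·` and `· 1ᴴ`
  simp only [Matrix.conjTranspose_one, Matrix.mul_one, Matrix.one_mul] at hc hcA hc' hcA'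
  -- FILE 133 at this `A′`: the majorant of `X` and the left-inverse identity
  obtain ⟨⟨hX, hXT, -⟩, ⟨hX', hXT', -⟩⟩ := H mv kk r hk hw₀ e he A' hA' rA hrA h1 h2 h3 hr2 hRle
  -- abbreviations
  set M := cvM d L mv kk hL with hM
  set τ := bshiftEquiv (cvM d L mv kk hL) (L ^ kk) with hτ
  set S : Fin (d + 1) → CvX d L mv kk hL → Matrix ι ι ℝ := fun μ x => coordMat e (ContinuousLinearMap.mulLeftRight ℝ (Matrix mm mm ℂ)
      (NormedSpace.exp (((((L ^ kk : ℕ) : ℝ))⁻¹) • gavgM (Matrix mm mm ℂ) (Fin (d + 1)) (kingPrV L kk r (cvM d L mv kk hL)) A' μ x))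
      (NormedSpace.exp (((((L ^ kk : ℕ) : ℝ))⁻¹) • gavgM (Matrix mm mm ℂ) (Fin (d + 1)) (kingPrV L kk r (cvM d L mv kk hL)) A' μ x))ᴴ) with hS
  have hn : 1 ≤ L ^ kk := Nat.one_le_pow kk L hLpos
  -- the species row `V_R = unstackM (c, a±)` with the mean-gauge letters (M1 `hasMaj_unstackM`)
  have hRc0 : 0 ≤ 14 * Real.exp 1 * (1 + Fintype.card (Fin (d + 1))) * basisConst e * ((1 + Fintype.card (Fin (d + 1))) * ((3 + 2 * ((d : ℝ) + 1)) * rA)) := by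
    have := basisConst_nonneg e; positivity
  have hV : HasMaj (BlockNorm.ofBlocks (unitTorusGeo L kk M) (blkPair (liftBlk (cvBlk d L mv kk hL) ι))) (CvNorm d L mv kk hL ι)
      (unstackM (tCoefC ((((L ^ kk : ℕ) : ℝ))⁻¹) (gaugePair τ S)) (tCoefA ((((L ^ kk : ℕ) : ℝ))⁻¹) (gaugePair τ S)))
      (diagK fun _ => 14 * Real.exp 1 * (1 + Fintype.card (Fin (d + 1))) * basisConst e * ((1 + Fintype.card (Fin (d + 1))) * ((3 + 2 * ((d : ℝ) + 1)) * rA)) *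
        (1 + Fintype.card (Fin (d + 1) ⊕ Fin (d + 1)))) :=
    hasMaj_unstackM (g := unitTorusGeo L kk M) (cvBlk d L mv kk hL) hRc0 hc hcA
  -- FILE 21: `G ⊗ 1` and its quotients, stacked
  obtain ⟨hG0, hD0, hG0', hD0', -⟩ := HG (⟨mv + 1, kk, hk, r⟩, (0 : Fin (d + 1)))
  have hG : HasMaj (CvNorm d L mv kk hL ι) (CvNorm d L mv kk hL ι) (tensorId ι (gOp M (L ^ kk) a))
      (fun y y' => βG * Real.exp (-(δG * (unitTorusGeo L kk M).dist y y'))) := hG0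
  have hD : ∀ μ, HasMaj (CvNorm d L mv kk hL ι) (CvNorm d L mv kk hL ι) (dPiecesM₂ d ι M (L ^ kk) a μ)
      (fun y y' => βG * Real.exp (-(δG * (unitTorusGeo L kk M).dist y y'))) := hD0
  have hSt : HasMaj (CvNorm d L mv kk hL ι) (BlockNorm.ofBlocks (unitTorusGeo L kk M) (blkPair (liftBlk (cvBlk d L mv kk hL) ι)))
      (stack (tensorId ι (gOp M (L ^ kk) a)) (dPiecesM₂ d ι M (L ^ kk) a)) (fun y y' => βG * Real.exp (-(δG * (unitTorusGeo L kk M).dist y y'))) :=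
    hasMaj_stack (g := unitTorusGeo L kk M) (liftBlk (cvBlk d L mv kk hL) ι) (fun _ _ => mul_nonneg hβG.le (Real.exp_nonneg _)) hG hD
  -- `V_R ∘ (G ⊗ 1)` (FILE 28's identity; a diagonal row costs no rate)
  have hVG : HasMaj (CvNorm d L mv kk hL ι) (CvNorm d L mv kk hL ι)
      (speciesOpM τ ((L ^ kk : ℕ) : ℝ) (tCoefC ((((L ^ kk : ℕ) : ℝ))⁻¹) (gaugePair τ S)) (tCoefA ((((L ^ kk : ℕ) : ℝ))⁻¹) (gaugePair τ S)) ∘ₗ tensorId ι (gOp M (L ^ kk) a))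
      (fun y y' => 14 * Real.exp 1 * (1 + Fintype.card (Fin (d + 1))) * basisConst e * ((1 + Fintype.card (Fin (d + 1))) * ((3 + 2 * ((d : ℝ) + 1)) * rA)) *
        (1 + Fintype.card (Fin (d + 1) ⊕ Fin (d + 1))) * βG * Real.exp (-(δG * (unitTorusGeo L kk M).dist y y'))) := by
    rw [← unstackM_comp_stack_eq_speciesOpM_comp τ ((L ^ kk : ℕ) : ℝ) (tensorId ι (gOp M (L ^ kk) a)) _ _ (D := dPiecesM₂ d ι M (L ^ kk) a)
      (fun μ => dPiecesM₂_inl (d := d) (ι := ι) M (L ^ kk) a μ) (fun μ => dPiecesM₂_inr (d := d) (ι := ι) M (L ^ kk) a μ)]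
    exact hasMaj_diagK_comp_exp (g := unitTorusGeo L kk M) (blkPair (liftBlk (cvBlk d L mv kk hL) ι)) (mul_nonneg hRc0 (by positivity)) hV hSt
  -- `X ∘ V_R ∘ (G ⊗ 1)` ([B11] composition with rates; margin `δ_G∕2`)
  have hXVG := hasMaj_comp_exp (b₁ := CvNorm d L mv kk hL ι) (b₂ := CvNorm d L mv kk hL ι) (b₃ := CvNorm d L mv kk hL ι) (ρ := δG / 2) (σ := δG / 2)
    (triangle254_unitTorusGeo L kk M) (fun y y' => unitTorusGeo_dist_nonneg L kk M y y')
    (show RowSum (unitTorusGeo L kk M) (δG / 2) cr from fun y => (rowSum_unitTorusGeo L kk M hσ y).trans (by rw [hcr]; linarith))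
    hB.le (by positivity) hσ.le (by linarith) (by linarith) hX hVG
  -- the increment identity, and the constant
  have hid := sub_tensorId_gOp_eq_of_comp_eq_id mv kk hL ha ι (gaugePair τ S) _ hXT
  constructor
  · exact (hXVG.congr fun f => by rw [hid]).mono fun y y' => le_of_eq (by rw [kappa_ofBlocks, hR₁]; ring)
  /- the FINE spacing `η′ = L^{−(r+k)}`: the same chain with FILE 128's objects, FILE 133's fine conjuncts and FILE 21's fine letters (blocks `blkFine ∘ kingPrV` = fine blocks,
  `blkFine_comp_kingPrV`) -/
  set τ' := bshiftEquiv (cvM d L mv kk hL) (L ^ r * L ^ kk) with hτ'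
  set S' : Fin (d + 1) → CvX' d L mv kk r hL → Matrix ι ι ℝ := fun μ x' => coordMat e (ContinuousLinearMap.mulLeftRight ℝ (Matrix mm mm ℂ)
      (NormedSpace.exp (((((L ^ r * L ^ kk : ℕ) : ℝ))⁻¹) • A' μ x')) (NormedSpace.exp (((((L ^ r * L ^ kk : ℕ) : ℝ))⁻¹) • A' μ x'))ᴴ) with hS'
  have hV' : HasMaj (BlockNorm.ofBlocks (unitTorusGeo L kk M) (blkPair (liftBlk (fun b : CvX' d L mv kk r hL => blockOf (L ^ r * L ^ kk) M b.1) ι)))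
      (BlockNorm.ofBlocks (unitTorusGeo L kk M) (liftBlk (fun b : CvX' d L mv kk r hL => blockOf (L ^ r * L ^ kk) M b.1) ι))
      (unstackM (tCoefC ((((L ^ r * L ^ kk : ℕ) : ℝ))⁻¹) (gaugePair τ' S')) (tCoefA ((((L ^ r * L ^ kk : ℕ) : ℝ))⁻¹) (gaugePair τ' S')))
      (diagK fun _ => 14 * Real.exp 1 * (1 + Fintype.card (Fin (d + 1))) * basisConst e * ((1 + Fintype.card (Fin (d + 1))) * ((3 + 2 * ((d : ℝ) + 1)) * rA)) *
        (1 + Fintype.card (Fin (d + 1) ⊕ Fin (d + 1)))) :=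
    hasMaj_unstackM (g := unitTorusGeo L kk M) (fun b : CvX' d L mv kk r hL => blockOf (L ^ r * L ^ kk) M b.1) hRc0 hc' hcA'
  rw [blkFine_comp_kingPrV] at hG0' hD0'
  have hG' : HasMaj (BlockNorm.ofBlocks (unitTorusGeo L kk M) (liftBlk (fun b : CvX' d L mv kk r hL => blockOf (L ^ r * L ^ kk) M b.1) ι))
      (BlockNorm.ofBlocks (unitTorusGeo L kk M) (liftBlk (fun b : CvX' d L mv kk r hL => blockOf (L ^ r * L ^ kk) M b.1) ι)) (tensorId ι (gOp M (L ^ r * L ^ kk) a))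
      (fun y y' => βG * Real.exp (-(δG * (unitTorusGeo L kk M).dist y y'))) := hG0'
  have hD' : ∀ μ, HasMaj (BlockNorm.ofBlocks (unitTorusGeo L kk M) (liftBlk (fun b : CvX' d L mv kk r hL => blockOf (L ^ r * L ^ kk) M b.1) ι))
      (BlockNorm.ofBlocks (unitTorusGeo L kk M) (liftBlk (fun b : CvX' d L mv kk r hL => blockOf (L ^ r * L ^ kk) M b.1) ι)) (dPiecesM₂ d ι M (L ^ r * L ^ kk) a μ)
      (fun y y' => βG * Real.exp (-(δG * (unitTorusGeo L kk M).dist y y'))) := hD0'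
  have hSt' := hasMaj_stack (g := unitTorusGeo L kk M) (liftBlk (fun b : CvX' d L mv kk r hL => blockOf (L ^ r * L ^ kk) M b.1) ι)
    (fun _ _ => mul_nonneg hβG.le (Real.exp_nonneg _)) hG' hD'
  have hVG' : HasMaj (BlockNorm.ofBlocks (unitTorusGeo L kk M) (liftBlk (fun b : CvX' d L mv kk r hL => blockOf (L ^ r * L ^ kk) M b.1) ι))
      (BlockNorm.ofBlocks (unitTorusGeo L kk M) (liftBlk (fun b : CvX' d L mv kk r hL => blockOf (L ^ r * L ^ kk) M b.1) ι))
      (speciesOpM τ' ((L ^ r * L ^ kk : ℕ) : ℝ) (tCoefC ((((L ^ r * L ^ kk : ℕ) : ℝ))⁻¹) (gaugePair τ' S')) (tCoefA ((((L ^ r * L ^ kk : ℕ) : ℝ))⁻¹) (gaugePair τ' S')) ∘ₗ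
        tensorId ι (gOp M (L ^ r * L ^ kk) a))
      (fun y y' => 14 * Real.exp 1 * (1 + Fintype.card (Fin (d + 1))) * basisConst e * ((1 + Fintype.card (Fin (d + 1))) * ((3 + 2 * ((d : ℝ) + 1)) * rA)) *
        (1 + Fintype.card (Fin (d + 1) ⊕ Fin (d + 1))) * βG * Real.exp (-(δG * (unitTorusGeo L kk M).dist y y'))) := by
    rw [← unstackM_comp_stack_eq_speciesOpM_comp τ' ((L ^ r * L ^ kk : ℕ) : ℝ) (tensorId ι (gOp M (L ^ r * L ^ kk) a)) _ _ (D := dPiecesM₂ d ι M (L ^ r * L ^ kk) a)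
      (fun μ => dPiecesM₂_inl (d := d) (ι := ι) M (L ^ r * L ^ kk) a μ) (fun μ => dPiecesM₂_inr (d := d) (ι := ι) M (L ^ r * L ^ kk) a μ)]
    exact hasMaj_diagK_comp_exp (g := unitTorusGeo L kk M) (blkPair (liftBlk (fun b : CvX' d L mv kk r hL => blockOf (L ^ r * L ^ kk) M b.1) ι))
      (mul_nonneg hRc0 (by positivity)) hV' hSt'
  have hXVG' := hasMaj_comp_exp (ρ := δG / 2) (σ := δG / 2)
    (triangle254_unitTorusGeo L kk M) (fun y y' => unitTorusGeo_dist_nonneg L kk M y y')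
    (show RowSum (unitTorusGeo L kk M) (δG / 2) cr from fun y => (rowSum_unitTorusGeo L kk M hσ y).trans (by rw [hcr]; linarith))
    hB.le (by positivity) hσ.le (by linarith) (by linarith) hX' hVG'
  have hn' : 1 ≤ L ^ r * L ^ kk := Nat.one_le_iff_ne_zero.mpr (Nat.mul_ne_zero (pow_ne_zero r hLpos.ne') (pow_ne_zero kk hLpos.ne'))
  have hid' := sub_tensorId_gOp_eq_of_comp_eq_id_fine mv kk r hL ha ι (gaugePair τ' S') _ hXT'
  exact (hXVG'.congr fun f => by rw [hid']).mono fun y y' => le_of_eq (by rw [kappa_ofBlocks, hR₁]; ring)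

end Letter

end Summit.QuantumFields.YangMills.BalabanUVNodes.N15.GluedZeroField
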